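import Literature.Geometry.Kaehler.ChernCharacterProofs
import Literature.Geometry.Kaehler.HermitianHolomorphicBundle
import Literature.Geometry.Kaehler.MayerVietoris
import HarnessLib

/-!
# The Chern connection of a Hermitian holomorphic line bundle presented by a cocycle

Layer `Literature/Geometry/Kaehler`. Bridge between the two cocycle vocabularies of the tree: a
`HolomorphicLineBundle ι E M` with a `HermitianMetric` `h` and its CHERN FORM
`HermitianMetric.localChernForm h i = (1/4π) d((d log h_i) ∘ J)` (Voisin I, §3.3.1; the carrier of
Lefschetz's theorem on `(1,1)`-classes, `AlgebraicGeometry/HodgeTheory/LefschetzOneOne*`), and a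
`SmoothComplexVectorBundle ι E M r` with a `Connection` `D` and its CHERN CHARACTER FORMS
`D.chernCharacterForm p i = (1/p!) tr((−Ω_i/2πi)ᵖ)` (Kobayashi, Ch. II (2.21); the carrier of
`AlgebraicGeometry/HodgeTheory/HolomorphicBundleChernCharacter`, `chernCharacterSet`).

For a holomorphic line cocycle `L` (frames `σ_i = g_ij σ_j`) we set up the rank-one smooth cocycle
`L.toSmoothCocycle` in Kobayashi's convention (`s_j = s_i g'_ij`, `g'_ij = g_ji`; holomorphic,
`toSmoothCocycle_isHolomorphic`) and, for a Hermitian metric `h` (`h_i = h(σ_i)`, `h_i = |g_ij|² h_j`),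
the **Chern connection** `h.chernConnection`, `ω_i = ∂ log h_i = d′(log h_i)` (Kobayashi, Ch. I
(4.12); Griffiths–Harris p. 73, "`θ = ∂ log h`"); the gauge law (1.16) `ω_j = ω_i + g'_ij⁻¹ dg'_ij` is
`∂ log h_j = ∂ log h_i + ∂ log |g_ji|²` with `∂ log |g|² = g⁻¹ dg` (`dPrime_ofReal_log_norm_sq`). Its
curvature is `Ω_i = dω_i = −(i/2) d((d log h_i) ∘ J)` (`curvature_chernConnection_apply`), whence
`chernCharacterForm_chernConnection_one_apply` — **`ch₁(L, D_h)|_{U_i} = (−1/2πi) Ω_i` is the Chern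
form `(1/4π) d((d log h_i) ∘ J)`** — and `isChernCharacterForm_of_isChernForm`: **a Chern form `θ` of
`(L, h)` (`HermitianMetric.IsChernForm h θ`) is a first Chern character form of the Chern connection
(`Connection.IsChernCharacterForm h.chernConnection 1 θ`)**, i.e. `ch₁ = c₁` (Kobayashi, Ch. II
(1.8)–(1.10); Voisin I, §3.3.1 with Thm. 7.10). Everything is proved; no named facts.

## References

* S. Kobayashi, *Differential Geometry of Complex Vector Bundles* (1987), Ch. I (1.16), (4.12);
  Ch. II (1.8)–(1.10), (2.21). [Kobayashi1987]
* C. Voisin, *Hodge Theory and Complex Algebraic Geometry I* (2002), §3.3.1, Thm. 7.10. [VoisinHodgeI2002]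
* P. Griffiths, J. Harris, *Principles of Algebraic Geometry* (1978), Ch. 0 §5 p. 73. [GriffithsHarris1978]
-/
noncomputable section

open scoped Manifold ContDiff Topology
open Set Filter Complex

namespace Literature.Geometry.Kaehler

/-! ### Flat Cauchy–Riemann computations -/

section Flat

variable {E : Type*} [NormedAddCommGroup E] [NormedSpace ℂ E]

/-- For `G` complex differentiable at `y₀` with derivative `D`, the real differential of
`2 Re G + L` is `w ↦ 2 Re (D w)`. [folklore] -/
theorem fderiv_ofReal_two_mul_re_add_apply {G : E → ℂ} {y₀ : E} (hG : DifferentiableAt ℂ G y₀)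
    (L : ℝ) (w : E) :
    fderiv ℝ (fun y ↦ ((2 * (G y).re + L : ℝ) : ℂ)) y₀ w = ((2 * (fderiv ℂ G y₀ w).re : ℝ) : ℂ) := by
  set D : E →L[ℂ] ℂ := fderiv ℂ G y₀ with hD_def
  have hD : HasFDerivAt G (D.restrictScalars ℝ) y₀ := hG.hasFDerivAt.restrictScalars ℝ
  have h1 : HasFDerivAt (fun y ↦ ((2 * (G y).re + L : ℝ) : ℂ))
      (Complex.ofRealCLM.comp ((2 : ℝ) • Complex.reCLM.comp (D.restrictScalars ℝ))) y₀ :=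
    Complex.ofRealCLM.hasFDerivAt.comp y₀
      (((Complex.reCLM.hasFDerivAt.comp y₀ hD).const_mul (2 : ℝ)).add_const L)
  rw [h1.fderiv]
  rfl

/-- `½ (2 Re a − i · 2 Re (i a)) = a`: recombination of a complex number from the real parts of
`a` and `i a`. [folklore] -/
theorem two_inv_smul_two_re_sub_I_mul_two_re_I_mul (a : ℂ) :
    (2⁻¹ : ℂ) * (((2 * a.re : ℝ) : ℂ) - I * ((2 * (I * a).re : ℝ) : ℂ)) = a := by
  apply Complex.ext
  · simp
  · simp

end Flat

/-! ### `∂ log |g|² = g⁻¹ dg` for `g` holomorphic and non-vanishing -/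

section DPrime

variable {E : Type*} [NormedAddCommGroup E] [NormedSpace ℂ E]
  {M : Type*} [TopologicalSpace M] [ChartedSpace E M]

/-- `d′f` unfolded: `d′f = ½ (df − i · (df) ∘ J)`. [cite: Kobayashi1987, Ch. I §4 (4.10)] -/
theorem dPrime_eq (f : M → ℂ) :
    dPrime E f = (2⁻¹ : ℂ) • (mextDeriv (MForm.ofFun 𝓘(ℝ, E) f) -
      Complex.I • (mextDeriv (MForm.ofFun 𝓘(ℝ, E) f)).compJ) :=
  rfl

/-- Evaluation of `d′f`: `(d′f)_x(v) = ½ (df_x(v) − i df_x(Jv))`. [cite: Kobayashi1987, Ch. I §4 (4.10)] -/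
theorem dPrime_apply (f : M → ℂ) (x : M) (v : Fin 1 → TangentSpace 𝓘(ℝ, E) x) :
    dPrime E f x v = (2⁻¹ : ℂ) * (mextDeriv (MForm.ofFun 𝓘(ℝ, E) f) x v -
      I * mextDeriv (MForm.ofFun 𝓘(ℝ, E) f) x (fun i ↦ tangentJ E x (v i))) :=
  rfl

/-- **Locality of `d′`**: functions that agree near `x` have the same `d′` at `x`. [folklore] -/
theorem dPrime_congr_of_eventuallyEq {f₁ f₂ : M → ℂ} {x : M} (h : f₁ =ᶠ[𝓝 x] f₂) :
    dPrime E f₁ x = dPrime E f₂ x := by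
  have h' : ∀ᶠ w in 𝓝 x, MForm.ofFun 𝓘(ℝ, E) f₁ w = MForm.ofFun 𝓘(ℝ, E) f₂ w := by
    filter_upwards [h] with w hw
    ext v
    rw [MForm.ofFun_apply, MForm.ofFun_apply, hw]
  have hd := mextDeriv_congr_of_eventuallyEq h'
  ext v
  rw [dPrime_apply, dPrime_apply, hd]

/-- **Additivity of `d′` at a point** at which both functions define smooth `0`-forms. [folklore] -/
theorem dPrime_add_apply {f₁ f₂ : M → ℂ} {x : M} (h₁ : (MForm.ofFun 𝓘(ℝ, E) f₁).SmoothAt x)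
    (h₂ : (MForm.ofFun 𝓘(ℝ, E) f₂).SmoothAt x) :
    dPrime E (f₁ + f₂) x = dPrime E f₁ x + dPrime E f₂ x := by
  have hadd : mextDeriv (MForm.ofFun 𝓘(ℝ, E) (f₁ + f₂)) x =
      mextDeriv (MForm.ofFun 𝓘(ℝ, E) f₁) x + mextDeriv (MForm.ofFun 𝓘(ℝ, E) f₂) x := by
    rw [MForm.ofFun_add, mextDeriv_add_apply h₁ h₂]
  ext v
  simp only [dPrime_apply, hadd, ContinuousAlternatingMap.add_apply]
  ring

variable [IsManifold 𝓘(ℝ, E) ∞ M]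

/-- **`∂ log |g|² = g⁻¹ dg` for `g` holomorphic and non-vanishing** on an open `V ∋ x` (Griffiths–Harris,
p. 73; the rank-one gauge computation behind Voisin I, §3.3.1). Proof: near `x`,
`log ‖g‖² = 2 Re G + log ‖g x‖²` with `G = log (g / g x)` holomorphic, whose differential `D` is
`ℂ`-linear, so `½ (d(2 Re G)(v) − i d(2 Re G)(iv)) = Re (D v) + i Im (D v) = D v = (g x)⁻¹ dg(v)`.
[cite: GriffithsHarris1978, Ch. 0 §5 p. 73] -/
theorem dPrime_ofReal_log_norm_sq [FiniteDimensional ℂ E] [IsManifold 𝓘(ℂ, E) ω M]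
    {g : M → ℂ} {V : Set M} (hg : MDifferentiableOn 𝓘(ℂ, E) 𝓘(ℂ, ℂ) g V) (hV : IsOpen V)
    (hg0 : ∀ z ∈ V, g z ≠ 0) {x : M} (hx : x ∈ V) :
    dPrime E (fun z ↦ (Real.log (‖g z‖ ^ 2) : ℂ)) x =
      (g x)⁻¹ • mextDeriv (MForm.ofFun 𝓘(ℝ, E) g) x := by
  set c : ℂ := g x with hc_def
  have hc : c ≠ 0 := hg0 x hx
  -- the local holomorphic logarithm `G = log (g / c)` on the open neighbourhood `V'` of `x`
  set G : M → ℂ := fun z ↦ Complex.log (c⁻¹ * g z) with hG_def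
  set V' : Set M := V ∩ (fun z ↦ c⁻¹ * g z) ⁻¹' Complex.slitPlane with hV'_def
  have hcg_cont : ContinuousOn (fun z ↦ c⁻¹ * g z) V := continuousOn_const.mul hg.continuousOn
  have hV'o : IsOpen V' := hcg_cont.isOpen_inter_preimage hV Complex.isOpen_slitPlane
  have hx1 : c⁻¹ * g x = 1 := by rw [← hc_def, inv_mul_cancel₀ hc]
  have hxV' : x ∈ V' := ⟨hx, show c⁻¹ * g x ∈ Complex.slitPlane from hx1 ▸ Complex.one_mem_slitPlane⟩
  -- `log ‖g‖² = 2 Re G + log ‖c‖²` on `V'`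
  have hlog : ∀ z ∈ V', (Real.log (‖g z‖ ^ 2) : ℂ) =
      ((2 * (G z).re + Real.log (‖c‖ ^ 2) : ℝ) : ℂ) := by
    intro z hz
    have hcn : ‖c‖ ≠ 0 := norm_ne_zero_iff.2 hc
    have hgn : ‖g z‖ ≠ 0 := norm_ne_zero_iff.2 (hg0 z hz.1)
    congr 1
    simp only [hG_def, Complex.log_re, norm_mul, norm_inv]
    rw [Real.log_mul (inv_ne_zero hcn) hgn, Real.log_inv, Real.log_pow, Real.log_pow]
    push_cast
    ring
  set φ := extChartAt 𝓘(ℝ, E) x with hφ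
  have hgx : MDifferentiableAt 𝓘(ℂ, E) 𝓘(ℂ, ℂ) g x := (hg x hx).mdifferentiableAt (hV.mem_nhds hx)
  have hgc : DifferentiableAt ℂ (g ∘ φ.symm) (φ x) :=
    differentiableAt_comp_extChartAt_symm_of_mdifferentiableAt hgx
  set Dg : E →L[ℂ] ℂ := fderiv ℂ (g ∘ φ.symm) (φ x) with hDg
  have hφx : φ.symm (φ x) = x := extChartAt_to_inv (I := 𝓘(ℝ, E)) x
  have hGD : HasFDerivAt (G ∘ φ.symm) (c⁻¹ • Dg) (φ x) := by
    have h1 : HasFDerivAt (fun y ↦ c⁻¹ * (g ∘ φ.symm) y) (c⁻¹ • Dg) (φ x) :=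
      hgc.hasFDerivAt.const_mul c⁻¹
    have h2 : c⁻¹ * (g ∘ φ.symm) (φ x) = 1 := by
      show c⁻¹ * g (φ.symm (φ x)) = 1
      rw [hφx, hx1]
    have h3 := h1.clog (by show c⁻¹ * (g ∘ φ.symm) (φ x) ∈ Complex.slitPlane; rw [h2]; exact Complex.one_mem_slitPlane)
    rwa [h2, inv_one, one_smul] at h3
  have hGc : DifferentiableAt ℂ (G ∘ φ.symm) (φ x) := hGD.differentiableAt
  have hev : ((fun z ↦ (Real.log (‖g z‖ ^ 2) : ℂ)) ∘ φ.symm) =ᶠ[𝓝 (φ x)]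
      fun y ↦ ((2 * ((G ∘ φ.symm) y).re + Real.log (‖c‖ ^ 2) : ℝ) : ℂ) := by
    have h1 : ∀ᶠ y in 𝓝 (φ x), φ.symm y ∈ V' := by
      refine (continuousAt_extChartAt_symm x).eventually ?_
      rw [extChartAt_to_inv]
      exact hV'o.mem_nhds hxV'
    filter_upwards [h1] with y hy
    exact hlog _ hy
  have hdg : ∀ w : E, fderiv ℝ (g ∘ φ.symm) (φ x) w = Dg w := fun w ↦ by
    rw [(hgc.hasFDerivAt.restrictScalars ℝ).fderiv]
    rfl
  ext v
  rw [dPrime_apply, mextDeriv_ofFun_apply, mextDeriv_ofFun_apply, ContinuousAlternatingMap.smul_apply,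
    mextDeriv_ofFun_apply]
  simp only [ModelWithCorners.Boundaryless.range_eq_univ, fderivWithin_univ, tangentJ_apply]
  rw [← hφ, hev.fderiv_eq, fderiv_ofReal_two_mul_re_add_apply hGc, fderiv_ofReal_two_mul_re_add_apply hGc,
    hGD.fderiv, hdg, smul_eq_mul]
  have hlin : (c⁻¹ • Dg) (HSMul.hSMul (β := E) (γ := E) Complex.I (v 0)) = I * (c⁻¹ • Dg) (v 0) := by
    simp only [FunLike.coe_smul, Pi.smul_apply, Dg.map_smul, smul_eq_mul]
    ring
  rw [hlin, two_inv_smul_two_re_sub_I_mul_two_re_I_mul, FunLike.coe_smul, Pi.smul_apply,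
    smul_eq_mul]

/-- **`d′f` is smooth at `x` if `f` is smooth near `x`** (`d` and `∘ J` preserve smoothness). [folklore] -/
theorem smoothAt_dPrime [IsManifold 𝓘(ℂ, E) ω M] {f : M → ℂ} {x : M}
    (hf : ∀ᶠ z in 𝓝 x, (MForm.ofFun 𝓘(ℝ, E) f).SmoothAt z) : (dPrime E f).SmoothAt x := by
  have hd : (mextDeriv (MForm.ofFun 𝓘(ℝ, E) f)).SmoothAt x := MForm.SmoothAt.mextDeriv hf
  rw [dPrime_eq]
  exact (hd.sub ((MForm.SmoothAt.compJ hd).smul_complex I)).smul_complex _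

/-- **`d d′f = −(i/2) d((df) ∘ J)`** at a point near which `f` is smooth (`dd f = 0`, Warner 2.20; `d` is
`ℂ`-linear): the curvature of a rank-one Chern connection. [cite: Kobayashi1987, Ch. I §4 (4.12)] -/
theorem mextDeriv_dPrime_apply [IsManifold 𝓘(ℂ, E) ω M] {f : M → ℂ} {x : M}
    (hf : ∀ᶠ z in 𝓝 x, (MForm.ofFun 𝓘(ℝ, E) f).SmoothAt z) :
    mextDeriv (dPrime E f) x =
      (-(2⁻¹ * I)) • mextDeriv (mextDeriv (MForm.ofFun 𝓘(ℝ, E) f)).compJ x := by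
  have hd : (mextDeriv (MForm.ofFun 𝓘(ℝ, E) f)).SmoothAt x := MForm.SmoothAt.mextDeriv hf
  have hdJ : (I • (mextDeriv (MForm.ofFun 𝓘(ℝ, E) f)).compJ).SmoothAt x :=
    (MForm.SmoothAt.compJ hd).smul_complex I
  rw [dPrime_eq, Literature.NumberTheory.Transcendental.mextDeriv_smul_complex_holds, Pi.smul_apply,
    mextDeriv_sub_apply hd hdJ, mextDeriv_mextDeriv_of_smoothAt hf,
    Literature.NumberTheory.Transcendental.mextDeriv_smul_complex_holds, Pi.smul_apply, zero_sub, smul_neg,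
    smul_smul, neg_smul]

end DPrime

/-! ### The rank-one smooth cocycle of a holomorphic line cocycle -/

namespace HolomorphicLineBundle

variable {ι : Type*} {E : Type*} [NormedAddCommGroup E] [NormedSpace ℂ E]
  {M : Type*} [TopologicalSpace M] [ChartedSpace E M]

namespace HermitianMetric

variable {L : HolomorphicLineBundle ι E M} (h : L.HermitianMetric)

/-- The weight `h_i = h(σ_i)` read as the complex-valued function `log h_i` (junk off `U_i`).
[cite: VoisinHodgeI2002, §3.3.1] -/
def logWeight (i : ι) : M → ℂ := fun x ↦ (Real.log (h.weight i x) : ℂ)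

/-- `log h_i` is real `C^∞` at the points of `U_i` (`h_i > 0` and `C^∞` there). [cite: VoisinHodgeI2002, §3.3.1] -/
theorem contMDiffAt_logWeight {i : ι} {x : M} (hx : x ∈ L.baseSet i) :
    ContMDiffAt 𝓘(ℝ, E) 𝓘(ℝ, ℂ) ∞ (h.logWeight i) x := by
  have h1 : ContMDiffAt 𝓘(ℝ, E) 𝓘(ℝ, ℝ) ∞ (h.weight i) x :=
    (h.contMDiffOn_weight i).contMDiffAt ((L.isOpen_baseSet i).mem_nhds hx)
  have h2 : ContDiffAt ℝ ∞ (fun t : ℝ ↦ (Real.log t : ℂ)) (h.weight i x) :=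
    Complex.ofRealCLM.contDiff.contDiffAt.comp _ (Real.contDiffAt_log.2 (h.weight_pos i x hx).ne')
  exact h2.comp_contMDiffAt h1

/-- Hence the `0`-form `log h_i` is smooth near every point of `U_i`. [folklore] -/
theorem eventually_smoothAt_ofFun_logWeight {i : ι} {x : M} (hx : x ∈ L.baseSet i) :
    ∀ᶠ z in 𝓝 x, (MForm.ofFun 𝓘(ℝ, E) (h.logWeight i)).SmoothAt z := by
  filter_upwards [(L.isOpen_baseSet i).mem_nhds hx] with z hz
  exact MForm.smoothAt_ofFun_of_contMDiffAt (h.contMDiffAt_logWeight hz)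

end HermitianMetric

variable [FiniteDimensional ℂ E] [IsManifold 𝓘(ℂ, E) ω M] [IsManifold 𝓘(ℝ, E) ∞ M]

/-- **The rank-one `C^∞` cocycle of a holomorphic line cocycle, in Kobayashi's convention**
`s_j = s_i g'_ij`: since `σ_i = g_ij σ_j` (Voisin), `g'_ij = g_ji`, real `C^∞` on `U_i ∩ U_j` because
holomorphic there (`contMDiffAt_real_of_mdifferentiableOn_complex`). [cite: Kobayashi1987, Ch. I §1 (1.15)] -/
def toSmoothCocycle (L : HolomorphicLineBundle ι E M) : SmoothComplexVectorBundle ι E M 1 where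
  baseSet := L.baseSet
  isOpen_baseSet := L.isOpen_baseSet
  exists_mem_baseSet := L.exists_mem_baseSet
  coordChange i j x := Matrix.of fun _ _ ↦ L.coordChange j i x
  contMDiffOn_coordChange i j _ _ x hx :=
    (contMDiffAt_real_of_mdifferentiableOn_complex (L.mdifferentiableOn_coordChange j i)
      ((L.isOpen_baseSet j).inter (L.isOpen_baseSet i)) ⟨hx.2, hx.1⟩).contMDiffWithinAt
  coordChange_self i x hx := by
    ext a b
    rw [Subsingleton.elim a b, Matrix.of_apply, Matrix.one_apply_eq, L.coordChange_self i hx]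
  coordChange_comp i j k x hx := by
    ext a b
    rw [Matrix.mul_apply, Fin.sum_univ_one, Matrix.of_apply, Matrix.of_apply, Matrix.of_apply, mul_comm]
    exact L.coordChange_comp k j i x ⟨⟨hx.2, hx.1.2⟩, hx.1.1⟩

/-- The trivialising sets of `L.toSmoothCocycle` are those of `L` (definitional). [folklore] -/
@[simp]
theorem toSmoothCocycle_baseSet (L : HolomorphicLineBundle ι E M) (i : ι) :
    L.toSmoothCocycle.baseSet i = L.baseSet i :=
  rfl

/-- The transition matrices of `L.toSmoothCocycle` are `g'_ij = (g_ji)`. [cite: Kobayashi1987, Ch. I §1 (1.15)] -/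
@[simp]
theorem toSmoothCocycle_coordChange_apply (L : HolomorphicLineBundle ι E M) (i j : ι) (x : M)
    (a b : Fin 1) : L.toSmoothCocycle.coordChange i j x a b = L.coordChange j i x :=
  rfl

/-- **`L.toSmoothCocycle` is a holomorphic cocycle** (the `g_ji` are holomorphic). [cite: Kobayashi1987, Ch. I §3] -/
theorem toSmoothCocycle_isHolomorphic (L : HolomorphicLineBundle ι E M) : L.toSmoothCocycle.IsHolomorphic :=
  fun i j _ _ ↦ by
    rw [toSmoothCocycle_baseSet, toSmoothCocycle_baseSet, inter_comm]
    exact L.mdifferentiableOn_coordChange j i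

/-! ### The Chern connection of a Hermitian metric -/

namespace HermitianMetric

variable {L : HolomorphicLineBundle ι E M} (h : L.HermitianMetric)

/-- **The gauge law of the forms `∂ log h_i`** (Kobayashi (1.16), rank one): on `U_i ∩ U_j`,
`∂ log h_j = ∂ log h_i + g_ij d g_ji` (`h_j = |g_ji|² h_i`, `∂ log |g_ji|² = g_ji⁻¹ dg_ji = g_ij dg_ji`).
[cite: Kobayashi1987, Ch. I §1 (1.16)] -/
theorem dPrime_logWeight_eq {i j : ι} {x : M} (hi : x ∈ L.baseSet i) (hj : x ∈ L.baseSet j) :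
    dPrime E (h.logWeight j) x = dPrime E (h.logWeight i) x +
      L.coordChange i j x • mextDeriv (MForm.ofFun 𝓘(ℝ, E) (L.coordChange j i)) x := by
  have hO : IsOpen (L.baseSet j ∩ L.baseSet i) := (L.isOpen_baseSet j).inter (L.isOpen_baseSet i)
  have hg0 : ∀ z ∈ L.baseSet j ∩ L.baseSet i, L.coordChange j i z ≠ 0 := L.coordChange_ne_zero j i
  have hlog : h.logWeight j =ᶠ[𝓝 x]
      h.logWeight i + fun y ↦ (Real.log (‖L.coordChange j i y‖ ^ 2) : ℂ) := by
    filter_upwards [hO.mem_nhds ⟨hj, hi⟩] with y hy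
    have hw := h.weight_eq j i y hy
    have hn : ‖L.coordChange j i y‖ ^ 2 ≠ 0 := pow_ne_zero 2 (norm_ne_zero_iff.2 (hg0 y hy))
    have hp : h.weight i y ≠ 0 := (h.weight_pos i y hy.2).ne'
    simp only [logWeight, Pi.add_apply, hw]
    rw [Real.log_mul hn hp]
    push_cast
    ring
  have hsm_i : (MForm.ofFun 𝓘(ℝ, E) (h.logWeight i)).SmoothAt x :=
    (h.eventually_smoothAt_ofFun_logWeight hi).self_of_nhds
  have hsm_g : (MForm.ofFun 𝓘(ℝ, E) fun y ↦ (Real.log (‖L.coordChange j i y‖ ^ 2) : ℂ)).SmoothAt x :=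
    MForm.smoothAt_ofFun_of_contMDiffAt (contMDiffAt_ofReal_log_norm_sq
      (contMDiffAt_real_of_mdifferentiableOn_complex (L.mdifferentiableOn_coordChange j i) hO ⟨hj, hi⟩)
      (hg0 x ⟨hj, hi⟩))
  rw [dPrime_congr_of_eventuallyEq hlog, dPrime_add_apply hsm_i hsm_g,
    dPrime_ofReal_log_norm_sq (L.mdifferentiableOn_coordChange j i) hO hg0 ⟨hj, hi⟩,
    inv_eq_of_mul_eq_one_right (L.coordChange_mul_symm j i hj hi)]

/-- **The Chern connection of `(L, h)`** on the rank-one cocycle `L.toSmoothCocycle`: in the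
holomorphic frame `σ_i`, `ω_i = ∂ log h_i = h_i⁻¹ ∂ h_i` (Kobayashi, Ch. I (4.12); Griffiths–Harris,
p. 73: "`θ = ∂ log h`"); the gauge law (1.16) is `dPrime_logWeight_eq`. [cite: Kobayashi1987, Ch. I §4 (4.12)] -/
def chernConnection : L.toSmoothCocycle.Connection where
  form i := Matrix.of fun _ _ ↦ dPrime E (h.logWeight i)
  isSmoothFormOn_form i _ _ x hx := smoothAt_dPrime (h.eventually_smoothAt_ofFun_logWeight hx)
  form_eq i j x hx a b := by
    obtain ⟨hi, hj⟩ := hx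
    have hone : L.coordChange i j x * L.coordChange j i x = 1 := L.coordChange_mul_symm i j hi hj
    ext v
    simp only [Matrix.of_apply, MatrixForm.mulRight_apply, MatrixForm.mulLeft_apply, Fin.sum_univ_one,
      MatrixForm.d_apply, MatrixForm.ofFun_apply, toSmoothCocycle_coordChange_apply,
      ContinuousAlternatingMap.add_apply, ContinuousAlternatingMap.smul_apply, smul_eq_mul,
      h.dPrime_logWeight_eq hi hj]
    rw [← mul_assoc, mul_comm (L.coordChange j i x), hone, one_mul]

/-- The connection forms of the Chern connection are `ω_i = ∂ log h_i`. [cite: Kobayashi1987, Ch. I §4 (4.12)] -/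
@[simp]
theorem chernConnection_form_apply (i : ι) (a b : Fin 1) :
    h.chernConnection.form i a b = dPrime E (h.logWeight i) :=
  rfl

/-- **The curvature of the Chern connection, `Ω_i = dω_i = −(i/2) d((d log h_i) ∘ J)`** on `U_i`
(`ω_i ∧ ω_i = 0` in rank one; `Ω = ∂̄∂ log h`). [cite: Kobayashi1987, Ch. I §4 (4.12)] -/
theorem curvature_chernConnection_apply {i : ι} {x : M} (hx : x ∈ L.baseSet i) (a b : Fin 1) :
    h.chernConnection.curvature i a b x =
      (-(2⁻¹ * I)) • mextDeriv (mextDeriv (MForm.ofFun 𝓘(ℝ, E) (h.logWeight i))).compJ x := by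
  have k1 : ∀ c : E [⋀^Fin 1]→L[ℝ] ℂ, c.wedge c = 0 := fun c ↦ by
    ext v
    simp only [ContinuousAlternatingMap.wedge_apply_one_one, ContinuousAlternatingMap.coe_zero, Pi.zero_apply]
    ring
  have key : ∀ α : MForm 𝓘(ℝ, E) M ℂ 1, (α.wedge α) x = 0 := fun α ↦ k1 (α x)
  change mextDeriv (h.chernConnection.form i a b) x +
      (∑ c, (h.chernConnection.form i a c).wedge (h.chernConnection.form i c b)) x = _
  simp only [chernConnection_form_apply, Fin.sum_univ_one]
  rw [key, add_zero, mextDeriv_dPrime_apply (h.eventually_smoothAt_ofFun_logWeight hx)]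

/-- The normalising constants: `(1/1!) (−1/2πi) · (−i/2) = 1/4π`. [folklore] -/
theorem chernCharacter_one_const :
    ((Nat.factorial 1 : ℂ)⁻¹ * (-1 / (2 * Real.pi * I)) ^ 1) * (-(2⁻¹ * I)) =
      ((1 / (4 * Real.pi) : ℝ) : ℂ) := by
  have hπ : (Real.pi : ℂ) ≠ 0 := Complex.ofReal_ne_zero.2 Real.pi_ne_zero
  have h2πI : (2 * Real.pi * I : ℂ) ≠ 0 := mul_ne_zero (mul_ne_zero two_ne_zero hπ) I_ne_zero
  rw [Nat.factorial_one, Nat.cast_one, inv_one, one_mul, pow_one, div_mul_eq_mul_div,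
    div_eq_iff h2πI]
  push_cast
  field_simp
  ring

/-- **`ch₁(L, D_h)` is the Chern form of `(L, h)`**: at every point of `U_i`,
`(1/1!) tr(−Ω_i/2πi) = (−1/2πi) (−i/2) d((d log h_i) ∘ J) = (1/4π) d((d log h_i) ∘ J) = localChernForm h i`
(`ch₁ = c₁`, Kobayashi, Ch. II (1.8)–(1.10)). [cite: Kobayashi1987, Ch. II §2 (2.21)] [cite: VoisinHodgeI2002, §3.3.1] -/
theorem chernCharacterForm_chernConnection_one_apply {i : ι} {x : M} (hx : x ∈ L.baseSet i) :
    h.chernConnection.chernCharacterForm 1 i x = h.localChernForm i x := by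
  rw [SmoothComplexVectorBundle.Connection.chernCharacterForm, Pi.smul_apply, Matrix.trace_fin_one,
    localChernForm, Pi.smul_apply]
  have hnpow : MatrixForm.npow (h.chernConnection.curvature i) 1 0 0 x =
      ((-(2⁻¹ * I)) • mextDeriv (mextDeriv (MForm.ofFun 𝓘(ℝ, E) (h.logWeight i))).compJ x :
        E [⋀^Fin 2]→L[ℝ] ℂ) := by
    rw [← h.curvature_chernConnection_apply hx 0 0, MatrixForm.npow_succ, MatrixForm.npow_zero,
      MatrixForm.one_wedge, MatrixForm.castDeg_apply, MatrixForm.castDeg_apply, MForm.castDeg_castDeg]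
    ext v
    rw [MForm.castDeg_apply]
    rfl
  rw [hnpow, smul_smul, chernCharacter_one_const, Complex.coe_smul]
  rfl

/-- **A Chern form of `(L, h)` is a first Chern character form of the Chern connection**: if
`θ = (1/4π) d((d log h_i) ∘ J)` on every `U_i` (`HermitianMetric.IsChernForm h θ`, Voisin I §3.3.1) then
`θ = ch₁(L, D_h)|_{U_i}` on every `U_i` (`Connection.IsChernCharacterForm h.chernConnection 1 θ`):
`ch₁ = c₁` for line bundles (Kobayashi, Ch. II (1.10)), represented by the Chern form (Voisin I,
Thm. 7.10). [cite: Kobayashi1987, Ch. II §1 (1.10)] [cite: VoisinHodgeI2002, §3.3.1] -/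
theorem isChernCharacterForm_of_isChernForm {θ : MForm 𝓘(ℝ, E) M ℂ 2} (hθ : h.IsChernForm θ) :
    h.chernConnection.IsChernCharacterForm 1 θ := fun i x hx ↦ by
  rw [hθ i x hx, h.chernCharacterForm_chernConnection_one_apply hx]

end HermitianMetric

end HolomorphicLineBundle

end Literature.Geometry.Kaehler
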